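import Mathlib
import Summits.ValiantsHypothesis.ValiantsHypothesis.Theorems.ValuativeGCTValuativeFlipTridiagonalSubmersion

/-!
# The few-letter table of `Det_m`, row `k` from hypothesis `H(k)`: border-determinantal `k`-ary
# forms ⇒ `K_m = pleth` on `≤ k` letters and no valuative flip on `≤ k`-row shapes

Crux `ValuativeGCT.ValuativeFlip` (stmt-ValiantsHypothesis-12624), wall-breaker axis D
("det-orbit-closure multiplicity bounds for detCensus", seat k3 gen 1 / 3).  Rows `≤ 2`
(`…TwoRowNoFlip`, `…DetEqFreeTwoLetters`) and row `3` (`…TridiagonalSubmersion`,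
`…TernaryFormsBorderDeterminantal`) of the few-row table were closed with the number of letters
hard-wired.  This file is the row-`k` bookkeeping ONCE, for every `k`, from the single hypothesis

  `H(k)`: every form of degree `m` in any `k` letters of `MatIdx m` lies in `Δ(det_m)`

(supplied for `k = 4, m ≤ 3` by the pencil density criterion `…PencilDensity` and the quaternary
certificates of `…QuaternaryCubicsBorderDeterminantal`; for `k ≤ 3` by the landed files):

* `exists_fin_range_superset_of_card_le` — a set of `≤ k` letters is covered by `k` letters.
* `linSubst_mem_orbitClosure_detFormLex_of_card_le_of_kForms` — `A · g ∈ Δ(det_m)` whenever the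
  rows of `A` outside a set of `≤ k` letters vanish.
* `orbitMultiplicity_le_det_of_support_card_le_of_kForms` — `Det_m` majorises every orbit closure
  on `≤ k` letters: `mult_χ ℂ[Δ_m(g)] ≤ K_m(χ)` for weights `χ` supported on `≤ k` letters.
* `weightVector_eq_zero_of_mem_orbitVanishingIdeal_det_of_support_card_le_of_kForms`,
  `det_orbitMultiplicity_eq_plethysmCoeff_of_support_card_le_of_kForms`,
  `det_orbitMultiplicity_eq_plethysmCoeffOfPartition_of_card_parts_le_of_kForms` — `Det_m` is
  EQUATION-FREE on `k` letters: `K_m(χ) = pleth(χ)`, `K_m(λ*) = a_λ(δ[m])` for `ℓ(λ) ≤ k`.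
* `noValuativeFlip_of_card_parts_le_of_kForms`, `succ_le_card_parts_of_valuativeFlip_of_kForms` —
  no valuative flip on `≤ k`-row shapes at this `m` (any `n ≤ m`, any centre), every flip witness
  has `≥ k + 1` rows.
* `orbitVanishingIdeal_detFormLex_eq_bot_of_allForms`, `det_orbitMultiplicity_eq_plethysmCoeff_of_allForms`
  — when ALL forms of degree `m` lie in `Δ(det_m)` (the case `k ≥ m²`, i.e. `m = 2`): the ideal of
  `Δ(det_m)` is zero and `K_m = pleth` for every weight.

References: BLMW, SIAM J. Comput. 40 (2011) §4.4, §5.3 (inheritance); Kadish–Landsberg,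
arXiv:1204.4693 Prop. 1.12; J. M. Landsberg, *Geometry and Complexity Theory* (2017) §6.8, §8.4.
-/

-- `Summit.ValiantsHypothesis.ValiantsHypothesis.…` is the tree's mandated single-conjunct layout (Sub = Summit).
set_option linter.dupNamespace false

namespace Summit.ValiantsHypothesis.ValiantsHypothesis.Theorems.ValuativeFlip

open scoped BigOperators Matrix
open Finset
open MvPolynomial
open Literature.NumberTheory.DiophantineGeometry Literature.Computability.AlgebraicComplexity

noncomputable section

/-! ## Covering `≤ k` letters by `k` letters -/

/-- A finite set with at most `k` elements is covered by the range of a map from `Fin k`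
(given a default element). [folklore] -/
theorem exists_fin_range_superset_of_card_le {α : Type*} (a₀ : α) (S : Finset α) {k : ℕ}
    (hS : S.card ≤ k) : ∃ ℓ : Fin k → α, (↑S : Set α) ⊆ Set.range ℓ := by
  classical
  refine ⟨fun i => if h : (i : ℕ) < S.card then (S.equivFin.symm ⟨i, h⟩ : α) else a₀, ?_⟩
  intro x hx
  have hx' : x ∈ S := Finset.mem_coe.mp hx
  set i : Fin S.card := S.equivFin ⟨x, hx'⟩ with hi
  refine ⟨⟨i, lt_of_lt_of_le i.2 hS⟩, ?_⟩
  simp only [Fin.is_lt, dif_pos, Fin.eta, hi, Equiv.symm_apply_apply]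

/-! ## Row `k` of the table from `H(k)` -/

section KForms

/-- **`k`-letter substitutions of a form of degree `m` lie in `Δ(det_m)`, under `H(k)`.** For `g`
homogeneous of degree `m ≥ 1`, a set `S` of at most `k` letters, and a matrix `A` whose rows
outside `S` vanish, `A · g ∈ Δ(det_m)` (the substituted form only involves the letters of `S`).
[this crux] -/
theorem linSubst_mem_orbitClosure_detFormLex_of_card_le_of_kForms {m k : ℕ} [NeZero m]
    (H : ∀ (a : Fin k → MatIdx m) (q : MvPolynomial (MatIdx m) ℂ), q.IsHomogeneous m →
      ↑q.vars ⊆ Set.range a → q ∈ orbitClosure (detFormLex ℂ m))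
    {g : MvPolynomial (MatIdx m) ℂ} (hg : g.IsHomogeneous m) (S : Finset (MatIdx m))
    (hS : S.card ≤ k) (A : Matrix (MatIdx m) (MatIdx m) ℂ) (hA : ∀ i, i ∉ S → ∀ j, A i j = 0) :
    linSubst (MatIdx m) ℂ A g ∈ orbitClosure (detFormLex ℂ m) := by
  classical
  have a₀ : MatIdx m := toLex ((0 : Fin m), (0 : Fin m))
  obtain ⟨ℓ, hℓ⟩ := exists_fin_range_superset_of_card_le a₀ S hS
  have hvars : ↑(linSubst (MatIdx m) ℂ A g).vars ⊆ Set.range ℓ := by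
    refine vars_linSubst_subset (A := Finset.univ) A (fun x l _ hx => hA x (fun hxS => hx (hℓ ?_)) l)
      (by simp)
    exact Finset.mem_coe.mpr hxS
  exact H ℓ _ (linSubst_isHomogeneous A hg) hvars

/-- **`Det_m` majorises every orbit closure on `k` letters, under `H(k)`.** For every form `g` of
degree `m ≥ 1` in the matrix variables and every weight `χ` of `GL_{m²}` supported on at most `k`
letters, `mult_χ ℂ[Δ_m(g)] ≤ mult_χ ℂ[Δ(det_m)]` (support transfer). [this crux] -/
theorem orbitMultiplicity_le_det_of_support_card_le_of_kForms {m k : ℕ} [NeZero m]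
    (H : ∀ (a : Fin k → MatIdx m) (q : MvPolynomial (MatIdx m) ℂ), q.IsHomogeneous m →
      ↑q.vars ⊆ Set.range a → q ∈ orbitClosure (detFormLex ℂ m))
    {g : MvPolynomial (MatIdx m) ℂ} (hg : g.IsHomogeneous m) (S : Finset (MatIdx m))
    (hS : S.card ≤ k) (χ : Weight (MatIdx m)) (hχ : ∀ i, i ∉ S → χ i = 0) :
    orbitMultiplicity ℂ g m χ ≤ orbitMultiplicity ℂ (detFormLex ℂ m) m χ :=
  NoValuativeFlip.orbitMultiplicity_le_of_weight_support (detFormLex ℂ m) g (NeZero.ne m) S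
    (fun A hA => linSubst_mem_orbitClosure_detFormLex_of_card_le_of_kForms H hg S hS A hA) χ hχ

/-- **A weight vector supported on `k` letters that vanishes on `Δ(det_m)` is zero, under `H(k)`**
(locality of weight vectors + `k`-letter forms lie in `Δ(det_m)`). [this crux] -/
theorem weightVector_eq_zero_of_mem_orbitVanishingIdeal_det_of_support_card_le_of_kForms {m k : ℕ} [NeZero m]
    (H : ∀ (a : Fin k → MatIdx m) (q : MvPolynomial (MatIdx m) ℂ), q.IsHomogeneous m →
      ↑q.vars ⊆ Set.range a → q ∈ orbitClosure (detFormLex ℂ m))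
    (S : Finset (MatIdx m)) (hS : S.card ≤ k) {χ : Weight (MatIdx m)} (hχ : ∀ i, i ∉ S → χ i = 0)
    {F : MvPolynomial (DegIdx (MatIdx m) m) ℂ} (hF : F ∈ weightSpace (coordRep (MatIdx m) ℂ m) χ)
    (hFI : F ∈ orbitVanishingIdeal (detFormLex ℂ m) m) : F = 0 := by
  classical
  apply MvPolynomial.funext
  intro c
  rw [map_zero]
  set q : MvPolynomial (MatIdx m) ℂ := ∑ d : DegIdx (MatIdx m) m, c d • monomial d.1 (1 : ℂ) with hq
  have hcq : formCoeff m q = c := formCoeff_sum_smul_monomial c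
  set D : Matrix (MatIdx m) (MatIdx m) ℂ := Matrix.diagonal fun i => if i ∈ S then (1 : ℂ) else 0
    with hD
  have hrows : ∀ i, i ∉ S → ∀ j, D i j = 0 := by
    intro i hi j
    rw [hD, Matrix.diagonal_apply, if_neg hi]
    split_ifs <;> rfl
  have hmem : linSubst (MatIdx m) ℂ D q ∈ orbitClosure (detFormLex ℂ m) :=
    linSubst_mem_orbitClosure_detFormLex_of_card_le_of_kForms H (isHomogeneous_sum_smul_monomial c)
      S hS D hrows
  have hFI' := orbitVanishingIdeal_le_of_mem_orbitClosure (m := m) hmem hFI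
  have h1 := mem_orbitVanishingIdeal_iff.mp hFI' 1
  simp only [map_one, Module.End.one_apply] at h1
  change aeval c F = 0
  rw [← hcq, NoValuativeFlip.aeval_formCoeff_eq_of_mem_weightSpace S hχ hF q]
  exact h1

/-- **`Det_m` is equation-free on `k` letters, under `H(k)`: `K_m(χ) = pleth(χ)`** for every weight
`χ` of `GL_{m²}` supported on at most `k` letters (`m ≥ 1`). [this crux] -/
theorem det_orbitMultiplicity_eq_plethysmCoeff_of_support_card_le_of_kForms {m k : ℕ} [NeZero m]
    (H : ∀ (a : Fin k → MatIdx m) (q : MvPolynomial (MatIdx m) ℂ), q.IsHomogeneous m →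
      ↑q.vars ⊆ Set.range a → q ∈ orbitClosure (detFormLex ℂ m))
    (S : Finset (MatIdx m)) (hS : S.card ≤ k) (χ : Weight (MatIdx m)) (hχ : ∀ i, i ∉ S → χ i = 0) :
    orbitMultiplicity ℂ (detFormLex ℂ m) m χ = plethysmCoeff ℂ (MatIdx m) m χ := by
  classical
  set V : Submodule ℂ (MvPolynomial (DegIdx (MatIdx m) m) ℂ) :=
    highestWeightSpace (coordRep (MatIdx m) ℂ m) χ with hV
  haveI : FiniteDimensional ℂ V :=
    finiteDimensional_highestWeightSpace_coordRep_holds (NeZero.ne m) χ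
  let π : (coordRep (MatIdx m) ℂ m).IntertwiningMap (orbitCoordRep (detFormLex ℂ m) m) :=
    ⟨(Ideal.Quotient.mkₐ ℂ (orbitVanishingIdeal (detFormLex ℂ m) m)).toLinearMap,
      fun _ => LinearMap.ext fun _ => rfl⟩
  have hmap := map_highestWeightSpace_eq_of_surjective π (Ideal.Quotient.mkₐ_surjective ℂ _)
    (isSemisimpleRepresentation_coordRep m) χ
  have hr := LinearMap.finrank_range_add_finrank_ker (π.toLinearMap ∘ₗ V.subtype)
  rw [LinearMap.range_comp, Submodule.range_subtype] at hr
  have hker : LinearMap.ker (π.toLinearMap ∘ₗ V.subtype) = ⊥ := by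
    rw [Submodule.eq_bot_iff]
    intro F hF0
    rw [LinearMap.mem_ker, LinearMap.comp_apply] at hF0
    have hFI : (F : MvPolynomial (DegIdx (MatIdx m) m) ℂ) ∈ orbitVanishingIdeal (detFormLex ℂ m) m :=
      Ideal.Quotient.eq_zero_iff_mem.mp hF0
    exact Subtype.ext
      (weightVector_eq_zero_of_mem_orbitVanishingIdeal_det_of_support_card_le_of_kForms H S hS hχ
        (highestWeightSpace_le_weightSpace _ _ F.2) hFI)
  rw [hker, finrank_bot, add_zero] at hr
  unfold orbitMultiplicity plethysmCoeff hwMultiplicity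
  rw [← hmap, ← hV]
  exact hr

/-- **Row `≤ k` of the few-row table, determinant column, under `H(k)`: `K_m(λ*) = a_λ(δ[m])`.**
For `λ ⊢ d` with `ℓ(λ) ≤ k` and any `k'` with `ℓ(λ) ≤ k' ≤ m²`, the multiplicity of `λ*` in
`ℂ[Δ(det_m)]` equals the `GL_{k'}` plethysm coefficient `plethysmCoeffOfPartition ℂ k' m λ`.
[this crux] -/
theorem det_orbitMultiplicity_eq_plethysmCoeffOfPartition_of_card_parts_le_of_kForms {m k : ℕ} [NeZero m]
    (H : ∀ (a : Fin k → MatIdx m) (q : MvPolynomial (MatIdx m) ℂ), q.IsHomogeneous m →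
      ↑q.vars ⊆ Set.range a → q ∈ orbitClosure (detFormLex ℂ m))
    {k' d : ℕ} (hk' : k' ≤ m * m) (lam : Nat.Partition d) (hk : lam.parts.card ≤ k)
    (hlam : lam.parts.card ≤ k') :
    orbitMultiplicity ℂ (detFormLex ℂ m) m (Weight.dualOfPartition (m * m) lam).toMatIdx =
      plethysmCoeffOfPartition ℂ k' m lam := by
  classical
  rw [← plethysmCoeff_toMatIdx_eq_plethysmCoeffOfPartition hk' lam hlam]
  set ρ := lam.parts.card with hρ
  have hρm : ρ ≤ m * m := hlam.trans hk'
  let S : Finset (MatIdx m) := Finset.univ.image fun t : Fin ρ =>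
    matIdxEquiv m ⟨m * m - 1 - t, by have := t.2; omega⟩
  have hScard : S.card ≤ k := Finset.card_image_le.trans (by simpa using hk)
  have hχ : ∀ i, i ∉ S → (Weight.dualOfPartition (m * m) lam).toMatIdx i = 0 := by
    intro i hi
    obtain ⟨i', rfl⟩ : ∃ i' : Fin (m * m), matIdxEquiv m i' = i :=
      ⟨(matIdxEquiv m).symm i, (matIdxEquiv m).apply_symm_apply i⟩
    by_cases hlt : (i' : ℕ) + ρ < m * m
    · exact NoValuativeFlip.dualOfPartition_toMatIdx_eq_zero_of_lt lam i' hlt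
    · exfalso
      apply hi
      refine Finset.mem_image.mpr ⟨⟨m * m - 1 - i', by omega⟩, Finset.mem_univ _, ?_⟩
      congr 1
      exact Fin.ext (by simp; omega)
  exact det_orbitMultiplicity_eq_plethysmCoeff_of_support_card_le_of_kForms H S hScard _ hχ

/-- `H(k)` for any `k` letters gives `H(k)` for the `k` greatest lexicographic letters (the
hypothesis of `noFlip_of_topForms_mem_orbitClosure`). [this crux] -/
theorem topForms_mem_orbitClosure_detFormLex_of_kForms {m k : ℕ} [NeZero m]
    (H : ∀ (a : Fin k → MatIdx m) (q : MvPolynomial (MatIdx m) ℂ), q.IsHomogeneous m →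
      ↑q.vars ⊆ Set.range a → q ∈ orbitClosure (detFormLex ℂ m))
    (q : MvPolynomial (MatIdx m) ℂ) (hq : q.IsHomogeneous m)
    (hvars : ∀ i ∈ q.vars, m * m ≤ (((matIdxEquiv m).symm i : Fin (m * m)) : ℕ) + k) :
    q ∈ orbitClosure (detFormLex ℂ m) := by
  classical
  have hmm : 0 < m * m := Nat.mul_pos (NeZero.pos m) (NeZero.pos m)
  by_cases hk : k ≤ m * m
  · let a : Fin k → MatIdx m := fun t => matIdxEquiv m ⟨m * m - 1 - t, by omega⟩
    refine H a q hq fun i hi => ?_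
    have h := hvars i (Finset.mem_coe.mp hi)
    refine ⟨⟨m * m - 1 - ((matIdxEquiv m).symm i : ℕ), by omega⟩, ?_⟩
    simp only [a]
    conv_rhs => rw [← (matIdxEquiv m).apply_symm_apply i]
    congr 1
    exact Fin.ext (by simp; omega)
  · push Not at hk
    let a : Fin k → MatIdx m := fun t =>
      if ht : (t : ℕ) < m * m then matIdxEquiv m ⟨t, ht⟩ else matIdxEquiv m ⟨0, hmm⟩
    refine H a q hq fun i _ => ?_
    refine ⟨⟨((matIdxEquiv m).symm i : ℕ), lt_trans ((matIdxEquiv m).symm i).2 hk⟩, ?_⟩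
    simp only [a, dif_pos ((matIdxEquiv m).symm i).2, Fin.eta, OrderIso.apply_symm_apply]

/-- **No valuative flip on shapes with at most `k` rows, under `H(k)`.** For every `n ≤ m`, every
centre `(U, r)` with ranks `≤ r` on `U`, every `δ` and every `λ ⊢ mδ` with `ℓ(λ) ≤ k` (and
`ℓ(λ) ≤ m²`), the crux's truncation `T_U(λ)` (verbatim body of `ValuativeGCT.ValuativeFlip`)
satisfies `mult_pp(λ*) ≤ dim T_U(λ)` — the `ValuativeFlip` inequality fails
(`noFlip_of_topForms_mem_orbitClosure` with its hypothesis supplied by `H(k)`). [this crux] -/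
theorem noValuativeFlip_of_card_parts_le_of_kForms {n : ℕ} (m : ℕ) [NeZero m] (hnm : n ≤ m) (k : ℕ)
    (H : ∀ (a : Fin k → MatIdx m) (q : MvPolynomial (MatIdx m) ℂ), q.IsHomogeneous m →
      ↑q.vars ⊆ Set.range a → q ∈ orbitClosure (detFormLex ℂ m))
    (U : Submodule ℂ (MatIdx m → ℂ)) (r : ℕ)
    (hU : ∀ u ∈ U, (Matrix.of fun a b : Fin m => u (toLex (a, b))).rank ≤ r)
    (δ : ℕ) (lam : Nat.Partition (m * δ)) (hk : lam.parts.card ≤ k) (hcard : lam.parts.card ≤ m * m) :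
    let χ : Literature.NumberTheory.DiophantineGeometry.Weight (Literature.NumberTheory.DiophantineGeometry.MatIdx m) := (Literature.NumberTheory.DiophantineGeometry.Weight.dualOfPartition (m * m) lam).toMatIdx; let T : Submodule ℂ (MvPolynomial (Literature.NumberTheory.DiophantineGeometry.MatIdx m × Literature.NumberTheory.DiophantineGeometry.MatIdx m) ℂ) := MvPolynomial.homogeneousSubmodule (Literature.NumberTheory.DiophantineGeometry.MatIdx m × Literature.NumberTheory.DiophantineGeometry.MatIdx m) ℂ (m * δ) ⊓ ((MvPolynomial.vanishingIdeal ℂ {p : Literature.NumberTheory.DiophantineGeometry.MatIdx m × Literature.NumberTheory.DiophantineGeometry.MatIdx m → ℂ | ∀ j : Literature.NumberTheory.DiophantineGeometry.MatIdx m, (fun i => p (j, i)) ∈ U}) ^ (δ * (m - r))).restrictScalars ℂ ⊓ (⨅ (M : Matrix (Literature.NumberTheory.DiophantineGeometry.MatIdx m) (Literature.NumberTheory.DiophantineGeometry.MatIdx m) ℂ) (_ : Literature.Computability.AlgebraicComplexity.linSubst (Literature.NumberTheory.DiophantineGeometry.MatIdx m) ℂ M (Literature.NumberTheory.DiophantineGeometry.detFormLex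 ℂ m) = Literature.NumberTheory.DiophantineGeometry.detFormLex ℂ m), LinearMap.ker ((MvPolynomial.aeval (R := ℂ) fun p : Literature.NumberTheory.DiophantineGeometry.MatIdx m × Literature.NumberTheory.DiophantineGeometry.MatIdx m => ∑ l : Literature.NumberTheory.DiophantineGeometry.MatIdx m, M l p.2 • MvPolynomial.X (p.1, l)).toLinearMap - LinearMap.id (R := ℂ) (M := MvPolynomial (Literature.NumberTheory.DiophantineGeometry.MatIdx m × Literature.NumberTheory.DiophantineGeometry.MatIdx m) ℂ))) ⊓ (⨅ (g : Matrix.GeneralLinearGroup (Literature.NumberTheory.DiophantineGeometry.MatIdx m) ℂ) (_ : Literature.NumberTheory.DiophantineGeometry.IsUpperTriangular g), LinearMap.ker ((MvPolynomial.aeval (R := ℂ) fun p : Literature.NumberTheory.DiophantineGeometry.MatIdx m × Literature.NumberTheory.DiophantineGeometry.MatIdx m => ∑ l : Literature.NumberTheory.DiophantineGeometry.MatIdx m, ((g⁻¹ : Matrix.GeneralLinearGroup (Literature.NumberTheory.DiophantineGeometry.MatIdx m) ℂ) : Matrix (Literature.NumberTheory.DiophantineGeometry.MatIdx m) (Literature.NumberTheory.DiophantineGeometry.MatIdx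 m) ℂ) p.1 l • MvPolynomial.X (l, p.2)).toLinearMap - Literature.NumberTheory.DiophantineGeometry.weightChar χ g • LinearMap.id (R := ℂ) (M := MvPolynomial (Literature.NumberTheory.DiophantineGeometry.MatIdx m × Literature.NumberTheory.DiophantineGeometry.MatIdx m) ℂ))); Literature.NumberTheory.DiophantineGeometry.orbitMultiplicity ℂ (Literature.NumberTheory.DiophantineGeometry.paddedPerFormLex ℂ n m) m χ ≤ Module.finrank ℂ ↥T :=
  noFlip_of_topForms_mem_orbitClosure m hnm k (topForms_mem_orbitClosure_detFormLex_of_kForms H)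
    U r hU δ lam hk hcard

/-- **Every valuative-flip witness has at least `k + 1` rows, under `H(k)`.** If the crux's
inequality `dim T_U(λ) < mult_pp(λ*)` holds at some admissible `(n, m, U, r, δ, λ)` (`n ≤ m`,
ranks `≤ r` on `U`, `ℓ(λ) ≤ m²`), then `k + 1 ≤ ℓ(λ)`. [this crux] -/
theorem succ_le_card_parts_of_valuativeFlip_of_kForms {n : ℕ} (m : ℕ) [NeZero m] (hnm : n ≤ m)
    (k : ℕ)
    (H : ∀ (a : Fin k → MatIdx m) (q : MvPolynomial (MatIdx m) ℂ), q.IsHomogeneous m →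
      ↑q.vars ⊆ Set.range a → q ∈ orbitClosure (detFormLex ℂ m))
    (U : Submodule ℂ (MatIdx m → ℂ)) (r : ℕ)
    (hU : ∀ u ∈ U, (Matrix.of fun a b : Fin m => u (toLex (a, b))).rank ≤ r)
    (δ : ℕ) (lam : Nat.Partition (m * δ)) (hcard : lam.parts.card ≤ m * m)
    (hflip : let χ : Literature.NumberTheory.DiophantineGeometry.Weight (Literature.NumberTheory.DiophantineGeometry.MatIdx m) := (Literature.NumberTheory.DiophantineGeometry.Weight.dualOfPartition (m * m) lam).toMatIdx; let T : Submodule ℂ (MvPolynomial (Literature.NumberTheory.DiophantineGeometry.MatIdx m × Literature.NumberTheory.DiophantineGeometry.MatIdx m) ℂ) := MvPolynomial.homogeneousSubmodule (Literature.NumberTheory.DiophantineGeometry.MatIdx m × Literature.NumberTheory.DiophantineGeometry.MatIdx m) ℂ (m * δ) ⊓ ((MvPolynomial.vanishingIdeal ℂ {p : Literature.NumberTheory.DiophantineGeometry.MatIdx m × Literature.NumberTheory.DiophantineGeometry.MatIdx m → ℂ | ∀ j : Literature.NumberTheory.DiophantineGeometry.MatIdx m, (fun i => p (j, i)) ∈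 U}) ^ (δ * (m - r))).restrictScalars ℂ ⊓ (⨅ (M : Matrix (Literature.NumberTheory.DiophantineGeometry.MatIdx m) (Literature.NumberTheory.DiophantineGeometry.MatIdx m) ℂ) (_ : Literature.Computability.AlgebraicComplexity.linSubst (Literature.NumberTheory.DiophantineGeometry.MatIdx m) ℂ M (Literature.NumberTheory.DiophantineGeometry.detFormLex ℂ m) = Literature.NumberTheory.DiophantineGeometry.detFormLex ℂ m), LinearMap.ker ((MvPolynomial.aeval (R := ℂ) fun p : Literature.NumberTheory.DiophantineGeometry.MatIdx m × Literature.NumberTheory.DiophantineGeometry.MatIdx m => ∑ l : Literature.NumberTheory.DiophantineGeometry.MatIdx m, M l p.2 • MvPolynomial.X (p.1, l)).toLinearMap - LinearMap.id (R := ℂ) (M := MvPolynomial (Literature.NumberTheory.DiophantineGeometry.MatIdx m × Literature.NumberTheory.DiophantineGeometry.MatIdx m) ℂ))) ⊓ (⨅ (g : Matrix.GeneralLinearGroup (Literature.NumberTheory.DiophantineGeometry.MatIdx m) ℂ) (_ : Literature.NumberTheory.DiophantineGeometry.IsUpperTriangular g), LinearMap.ker ((MvPolynomial.aeval (R := ℂ)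 fun p : Literature.NumberTheory.DiophantineGeometry.MatIdx m × Literature.NumberTheory.DiophantineGeometry.MatIdx m => ∑ l : Literature.NumberTheory.DiophantineGeometry.MatIdx m, ((g⁻¹ : Matrix.GeneralLinearGroup (Literature.NumberTheory.DiophantineGeometry.MatIdx m) ℂ) : Matrix (Literature.NumberTheory.DiophantineGeometry.MatIdx m) (Literature.NumberTheory.DiophantineGeometry.MatIdx m) ℂ) p.1 l • MvPolynomial.X (l, p.2)).toLinearMap - Literature.NumberTheory.DiophantineGeometry.weightChar χ g • LinearMap.id (R := ℂ) (M := MvPolynomial (Literature.NumberTheory.DiophantineGeometry.MatIdx m × Literature.NumberTheory.DiophantineGeometry.MatIdx m) ℂ))); Module.finrank ℂ ↥T < Literature.NumberTheory.DiophantineGeometry.orbitMultiplicity ℂ (Literature.NumberTheory.DiophantineGeometry.paddedPerFormLex ℂ n m) m χ) :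
    k + 1 ≤ lam.parts.card := by
  by_contra h
  exact absurd hflip (not_lt.mpr
    (noValuativeFlip_of_card_parts_le_of_kForms m hnm k H U r hU δ lam (by omega) hcard))

end KForms

/-! ## All forms border-determinantal: the ideal of `Δ(det_m)` vanishes -/

section AllForms

/-- **If every form of degree `m` lies in `Δ(det_m)`, the ideal of `Δ(det_m)` is zero**: a
polynomial in the degree-`m` coefficients vanishing on `GL · det_m` vanishes at every form of
degree `m` (`orbitVanishingIdeal_le_of_mem_orbitClosure`), i.e. at every point of `Sym^m ℂ^{m²}`,
hence is `0`. [this crux] -/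
theorem orbitVanishingIdeal_detFormLex_eq_bot_of_allForms {m : ℕ}
    (H : ∀ q : MvPolynomial (MatIdx m) ℂ, q.IsHomogeneous m → q ∈ orbitClosure (detFormLex ℂ m)) :
    orbitVanishingIdeal (detFormLex ℂ m) m = ⊥ := by
  classical
  refine (Submodule.eq_bot_iff _).mpr fun F hFI => ?_
  apply MvPolynomial.funext
  intro c
  rw [map_zero]
  set q : MvPolynomial (MatIdx m) ℂ := ∑ d : DegIdx (MatIdx m) m, c d • monomial d.1 (1 : ℂ) with hq
  have hcq : formCoeff m q = c := formCoeff_sum_smul_monomial c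
  have hFI' := orbitVanishingIdeal_le_of_mem_orbitClosure (m := m)
    (H q (isHomogeneous_sum_smul_monomial c)) hFI
  have h1 := mem_orbitVanishingIdeal_iff.mp hFI' 1
  simp only [map_one, Module.End.one_apply] at h1
  change aeval c F = 0
  rw [← hcq]
  exact h1

/-- **If every form of degree `m ≥ 1` lies in `Δ(det_m)`, then `K_m(χ) = pleth(χ)` for EVERY
weight `χ`**: the quotient map `ℂ[Sym^m] → ℂ[Δ(det_m)]` is an isomorphism. [this crux] -/
theorem det_orbitMultiplicity_eq_plethysmCoeff_of_allForms {m : ℕ} [NeZero m]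
    (H : ∀ q : MvPolynomial (MatIdx m) ℂ, q.IsHomogeneous m → q ∈ orbitClosure (detFormLex ℂ m))
    (χ : Weight (MatIdx m)) :
    orbitMultiplicity ℂ (detFormLex ℂ m) m χ = plethysmCoeff ℂ (MatIdx m) m χ := by
  classical
  refine det_orbitMultiplicity_eq_plethysmCoeff_of_support_card_le_of_kForms (k := m * m)
    (fun _ q hq _ => H q hq) Finset.univ (by simp) χ fun i hi => absurd (Finset.mem_univ i) hi

end AllForms

end

end Summit.ValiantsHypothesis.ValiantsHypothesis.Theorems.ValuativeFlip
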